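import Summits.BirchSwinnertonDyer.BirchSwinnertonDyer.Theorems.PublishedInputsGreenbergTheoremFourOneNonAnomalous
import Summits.BirchSwinnertonDyer.Rank1Residual.Additive.LocalTowerKernelCardEqTamagawaCyclotomic
import Literature.NumberTheory.EllipticCurves.TamagawaSubgroupProofs
import Literature.NumberTheory.EllipticCurves.TamagawaFiniteIndexProofs
import Literature.NumberTheory.EllipticCurves.Greenberg1999.ControlLocalKernelsLayer
import HarnessLib

set_option linter.dupNamespace false -- `…BirchSwinnertonDyer.BirchSwinnertonDyer…` is the cell's nested layout (D-0017)
set_option autoImplicit false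

/-!
# Greenberg LNM 1716 Thm. 4.1 over `ℚ` (`E(ℚ)[p] = 0`) with the EXACT Tamagawa factor `p^{ord_p ∏_ℓ c_ℓ}`:
# `f_E(0) = u · p^{ord_p ∏ c_ℓ} · #𝒦_{p,0}[p^∞] · #Sel_{p^∞}(E/ℚ)` — only the local order AT `p` left symbolic

Seat `bsd-inputs-k4-p1` (gen 5; LADDER-BSD D-0154 KEY (147)(f) «prove the printed input», row 1 K4 INPUTS; Greenberg
1999), `--supports stmt-BirchSwinnertonDyer-20309`. THEOREMS ONLY (no definition, no named fact, no `sorry`).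

R. Greenberg, *Iwasawa theory for elliptic curves*, LNM 1716 (1999), Thm. 4.1 (p. 85 printed / p. 102 of the held copy):
"`f_E(0) ∼ (∏_{v bad} c_v^{(p)}) (∏_{v∣p} |Ẽ_v(f_v)_p|²) |Sel_E(F)_p| / |E(F)_p|²`". Gen 4 proved (sibling file
`PublishedInputsGreenbergKerGCountOfCassels`, `InputsGreenbergKerG.constantCoeff_charGenerator_eq_ordinary_rat`) for
`F = ℚ`, good ordinary `p`, `E(ℚ)[p] = 0`, `Sel_{p^∞}(E/ℚ)` finite: `f(0) = u · #Sel_{p^∞}(E/ℚ) · ∏_{v ∈ S} #𝒦_{v,0}[p^∞]`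
for any finite `S ⊇ {bad} ∪ {p}`, leaving the LOCAL orders. The local order at `v ∤ p` is Greenberg's Lemma 3.3 reading
"`|ker(r_v)| = c_v^{(p)}`" (p. 88), which the tree PROVES exactly at the layer `n = 0` for the cyclotomic `ℤ_p`-extension
of any number field and any reduction type (cell b2b-bsdres, `Rank1Residual.Additive.natCard_localTowerKerPrimary_zero_eq_pow_of_isCyclotomic`:
`#𝒦_{v,0}[p^∞] = p^{ord_p c_v}`, `c_v = (W ⊗ K_v).localTamagawaNumber 𝒪_v`). Assembling the finite product over the bad
places into the Tamagawa product `∏ᶠ_v c_v = W.tamagawaProduct` (`c_v = 1` at good `v`,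
`localTamagawaNumber_eq_one_of_hasGoodReductionAt_holds`; every `c_v ≠ 0`, `localTamagawaNumber_baseChange_ne_zero`):

* `prod_natCard_localTowerKerPrimary_zero_eq_pow_mul` — for `W/ℚ` elliptic with good reduction at `p`, `κ` cyclotomic,
  `v₀ ∋ p` and any finite `S ⊇ {bad} ∪ {v₀}`: `∏_{v ∈ S} #𝒦_{v,0}[p^∞] = p^{ord_p(W.tamagawaProduct)} · #𝒦_{v₀,0}[p^∞]`.
* `constantCoeff_charGenerator_eq_tamagawa_mul_local_rat` — **Thm. 4.1 over `ℚ` with the exact Tamagawa factor**: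
  `GoodOrd W p`, `κ` cyclotomic with topological generator `γ`, `Sel_{p^∞}(E/ℚ)` finite, `E(ℚ)[p] = 0`, any dual datum
  `D` with `char X = (f)`, `v₀ ∋ p`: `X` is f.g. `Λ`-torsion and
  **`f(0) = u · #Sel_{p^∞}(E/ℚ) · p^{ord_p ∏_ℓ c_ℓ} · #𝒦_{v₀,0}[p^∞]`**, `u ∈ ℤ_pˣ`.
* `constantCoeff_charGenerator_eq_tamagawa_of_nonAnomalous` — **UNCONDITIONAL in the regime «good ordinary
  NON-ANOMALOUS `p`, `E(ℚ)[p] = 0`, `Sel_{p^∞}(E/ℚ)` finite»**: `f(0) = u · #Sel_{p^∞}(E/ℚ) · p^{ord_p ∏_ℓ c_ℓ}` (the local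
  order at `p` is `1` by `Rank1Residual.Iwasawa.GoodOrdinary.localTowerKerPrimary_zero_eq_bot_of_goodOrdinary_nonAnomalous`);
  this removes the hypothesis `p ∤ ∏ c_ℓ` of gen 4's `…_of_nonAnomalous`.
* `constantCoeff_charGenerator_eq_printed_of_lemma34` — the PRINTED shape
  `f(0) = u · p^{ord_p ∏ c_ℓ} · (p^{ord_p #Ẽ(𝔽_p)})² · #Sel_{p^∞}(E/ℚ)` from the tree's named fact
  `Greenberg1999.lemma34_natCard_localTowerKerPrimary_eq_rat` (Lemma 3.4, used at `n = 0` only) — CONDITIONAL on that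
  named fact (a `conditional-result`); the anomalous local order `#𝒦_{p,0}[p^∞] = #Ẽ(𝔽_p)[p^∞]²` is the one input of
  Thm. 4.1 over `ℚ` (case `E(ℚ)[p] = 0`) not yet a tree theorem.

HONEST FRAMING: compositions of tree theorems; the named fact `greenberg_charValue_rankZero` is NOT discharged (its
anomalous factor at `p` rests on Lemma 3.4, its `E(ℚ)[p] ≠ 0` case on Prop. 4.9); no item is closed; no summit statement
is proved; BSD is not proved by any of this.

References: [GreenbergLNM1716] Thm. 4.1 (p. 85), §3 Lemmas 3.3–3.4 (pp. 86–89), §4 Lemmas 4.2–4.7 (pp. 102–108);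
[SilvermanAEC2009] VII.2 (remark after Prop. 2.1), Cor. VII.6.2.
-/

noncomputable section

open scoped Classical NumberField

open NumberField IsDedekindDomain Field

namespace Summit.BirchSwinnertonDyer.BirchSwinnertonDyer.Theorems.InputsGreenbergKerG

open Literature.NumberTheory.EllipticCurves Literature.NumberTheory.GaloisRepresentations
  WeierstrassCurve ZpExtension Literature.NumberTheory.EllipticCurves.IwasawaAlgebra
  Literature.NumberTheory.EllipticCurves.Rank1Residual

/-! ## §1 The finite product of the local orders away from `p` is `p^{ord_p ∏_ℓ c_ℓ}` -/

/-- Bookkeeping: `∏_{i ∈ s} p^{ord_p (c i)} = p^{ord_p ∏_{i ∈ s} c i}` when no `c i` vanishes. [folklore] -/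
private theorem prod_pow_padicValNat_eq {ι : Type*} (s : Finset ι) (p : ℕ) [hp : Fact p.Prime] (c : ι → ℕ)
    (hc : ∀ i ∈ s, c i ≠ 0) : ∏ i ∈ s, p ^ padicValNat p (c i) = p ^ padicValNat p (∏ i ∈ s, c i) := by
  induction s using Finset.induction_on with
  | empty => simp
  | insert a s ha ih =>
    have hcs : ∀ i ∈ s, c i ≠ 0 := fun i hi ↦ hc i (Finset.mem_insert_of_mem hi)
    have hprod : ∏ i ∈ s, c i ≠ 0 := Finset.prod_ne_zero_iff.mpr hcs
    rw [Finset.prod_insert ha, Finset.prod_insert ha, ih hcs,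
      padicValNat.mul (hc a (Finset.mem_insert_self a s)) hprod, pow_add]

/-- Over `ℚ` there is only one finite place above `p`. [folklore] -/
private theorem eq_of_natCast_mem {p : ℕ} [hp : Fact p.Prime] {v v' : HeightOneSpectrum (𝓞 ℚ)}
    (hv : ((p : ℕ) : 𝓞 ℚ) ∈ v.asIdeal) (hv' : ((p : ℕ) : 𝓞 ℚ) ∈ v'.asIdeal) : v' = v := by
  apply (Rat.HeightOneSpectrum.primesEquiv (R := 𝓞 ℚ)).injective
  exact Subtype.ext ((Rat.HeightOneSpectrum.primesEquiv_eq_of_natCast_mem v' hp.out hv').trans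
    (Rat.HeightOneSpectrum.primesEquiv_eq_of_natCast_mem v hp.out hv).symm)

/-- **The local orders away from `p` multiply to `p^{ord_p ∏_ℓ c_ℓ}`** (Greenberg's Lemma 3.3 reading
"`|ker(r_v)| = c_v^{(p)}`", p. 88, assembled over the bad places). For `W/ℚ` elliptic with good reduction at `p`, the
cyclotomic `ℤ_p`-extension `κ`, the place `v₀ ∋ p`, and any finite `S` containing `v₀` and the bad places:
`∏_{v ∈ S} #𝒦_{v,0}[p^∞] = p^{ord_p (W.tamagawaProduct)} · #𝒦_{v₀,0}[p^∞]` — the factors at `v ≠ v₀` are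
`p^{ord_p c_v}` (`Rank1Residual.Additive.natCard_localTowerKerPrimary_zero_eq_pow_of_isCyclotomic`), `c_v = 1` off `S` and at
`v₀` (good reduction), and `∏ᶠ_v c_v` is the Tamagawa product.
[cite: GreenbergLNM1716, §3 Lemma 3.3 and p. 88] [cite: SilvermanAEC2009, VII.2 (remark after Prop. 2.1) and Cor. VII.6.2] -/
theorem prod_natCard_localTowerKerPrimary_zero_eq_pow_mul {p : ℕ} [hp : Fact p.Prime]
    (W : WeierstrassCurve ℚ) [W.IsElliptic] (hgood : W.HasGoodReductionAtPrime p)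
    (κ : ZpExtension ℚ p) (hκ : κ.IsCyclotomic) {v₀ : HeightOneSpectrum (𝓞 ℚ)} (hv₀ : ((p : ℕ) : 𝓞 ℚ) ∈ v₀.asIdeal)
    (S : Finset (HeightOneSpectrum (𝓞 ℚ))) (hS : ∀ v ∉ S, ((p : ℕ) : 𝓞 ℚ) ∉ v.asIdeal ∧ W.HasGoodReductionAt v) :
    ∏ v ∈ S, Nat.card (W.localTowerKerPrimary κ (v.adicCompletion ℚ) 0) =
      p ^ padicValNat p W.tamagawaProduct * Nat.card (W.localTowerKerPrimary κ (v₀.adicCompletion ℚ) 0) := by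
  -- notation: the local Tamagawa numbers
  set c : HeightOneSpectrum (𝓞 ℚ) → ℕ := fun v ↦
    (W.baseChange (v.adicCompletion ℚ)).localTamagawaNumber (v.adicCompletionIntegers ℚ) with hc
  have hc1 : ∀ v, W.HasGoodReductionAt v → c v = 1 := fun v hv ↦
    W.localTamagawaNumber_eq_one_of_hasGoodReductionAt_holds v hv
  have hc0 : ∀ v, c v ≠ 0 := fun v ↦ W.localTamagawaNumber_baseChange_ne_zero v
  have hv₀S : v₀ ∈ S := by
    by_contra h
    exact (hS v₀ h).1 hv₀
  have hgood₀ : W.HasGoodReductionAt v₀ := W.hasGoodReductionAt_of_hasGoodReductionAtPrime v₀ hv₀ hgood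
  -- split off `v₀`
  rw [← Finset.mul_prod_erase S _ hv₀S, mul_comm]
  congr 1
  -- the factors at `v ≠ v₀` (`v ∤ p`)
  have hne : ∀ v ∈ S.erase v₀, ((p : ℕ) : 𝓞 ℚ) ∉ v.asIdeal := fun v hv hpv ↦
    (Finset.mem_erase.mp hv).1 (eq_of_natCast_mem hv₀ hpv)
  rw [Finset.prod_congr rfl fun v hv ↦
    Summit.BirchSwinnertonDyer.Rank1Residual.Additive.natCard_localTowerKerPrimary_zero_eq_pow_of_isCyclotomic W hκ
      (hne v hv), prod_pow_padicValNat_eq _ p c fun v _ ↦ hc0 v]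
  congr 2
  -- the finite product is the Tamagawa product
  symm
  apply finprod_eq_prod_of_mulSupport_subset
  intro v hv
  rw [Function.mem_mulSupport] at hv
  rw [Finset.coe_erase, Set.mem_sdiff, Set.mem_singleton_iff, Finset.mem_coe]
  refine ⟨?_, ?_⟩
  · by_contra h
    exact hv (hc1 v (hS v h).2)
  · rintro rfl
    exact hv (hc1 _ hgood₀)

/-! ## §2 Theorem 4.1 over `ℚ` with the exact Tamagawa factor -/

/-- **Greenberg LNM 1716 Thm. 4.1 over `ℚ` at a good ORDINARY `p` with `E(ℚ)[p] = 0`, the Tamagawa factor EXACT and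
the local order at `p` symbolic.** For `W/ℚ` globally minimal and elliptic, `GoodOrd W p`, `κ` the cyclotomic
`ℤ_p`-extension with topological generator `γ`, `Sel_{p^∞}(E/ℚ)` finite, `E(ℚ)[p] = 0`, any Pontryagin-dual datum `D` of
`Sel_{p^∞}(E/ℚ_∞)` with `char(X) = (f)`, and the place `v₀ ∋ p`: `X` is finitely generated `Λ`-torsion and
**`f(0) = u · #Sel_{p^∞}(E/ℚ) · p^{ord_p(∏_ℓ c_ℓ)} · #𝒦_{v₀,0}[p^∞]`** for some `u ∈ ℤ_pˣ`
(`constantCoeff_charGenerator_eq_ordinary_rat` with `S = {bad} ∪ {v₀}` and §1). Greenberg's printed value of the last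
factor is `|Ẽ(𝔽_p)_p|²` (Lemma 3.4). [cite: GreenbergLNM1716, Thm. 4.1 (p. 85), §3 Lemma 3.3 (p. 88), §4 Lemmas 4.2–4.7 (pp. 102–108)] -/
theorem constantCoeff_charGenerator_eq_tamagawa_mul_local_rat {p : ℕ} [hp : Fact p.Prime]
    (W : WeierstrassCurve ℚ) [W.IsGloballyMinimal] [W.IsElliptic] (hgo : GoodOrd W p)
    (κ : ZpExtension ℚ p) (hκ : κ.IsCyclotomic) {γ : absoluteGaloisGroup ℚ} (hγ : κ.IsTopGenerator γ)
    (D : W.SelmerDualData κ γ) [Finite (W.selmerGroupPInfty p)] (hK : ∀ P : W.toAffine.Point, p • P = 0 → P = 0)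
    {v₀ : HeightOneSpectrum (𝓞 ℚ)} (hv₀ : ((p : ℕ) : 𝓞 ℚ) ∈ v₀.asIdeal)
    (f : IwasawaAlgebra p) (hf : Module.charIdeal (IwasawaAlgebra p) D.X = Ideal.span {f}) :
    Module.Finite (IwasawaAlgebra p) D.X ∧ Module.IsTorsion (IwasawaAlgebra p) D.X ∧
      ∃ u : ℤ_[p]ˣ, PowerSeries.constantCoeff f =
        u * Nat.card (W.selmerGroupPInfty p) * p ^ padicValNat p W.tamagawaProduct *
          Nat.card (W.localTowerKerPrimary κ (v₀.adicCompletion ℚ) 0) := by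
  have hord : W.HasGoodReductionAtPrime p ∧ ¬ ((p : ℕ) : ℤ) ∣ W.frobeniusTrace p := hgo
  -- a finite set `S` containing the bad places and `v₀`
  obtain ⟨S₀, hgoodS, -⟩ := SignedEC.ResTwo.exists_finset_mem_unramifiedOutside W p κ.kerSubgroup
    (0 : W.subgroupH1 p κ.kerSubgroup)
  let S : Finset (HeightOneSpectrum (𝓞 ℚ)) := insert v₀ S₀
  have hS : ∀ v ∉ S, ((p : ℕ) : 𝓞 ℚ) ∉ v.asIdeal ∧ W.HasGoodReductionAt v := by
    intro v hv
    rw [Finset.mem_insert, not_or] at hv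
    have hpv : ((p : ℕ) : 𝓞 ℚ) ∉ v.asIdeal := fun h ↦ hv.1 (eq_of_natCast_mem hv₀ h)
    exact ⟨hpv, hgoodS v hv.2 hpv⟩
  obtain ⟨hFG, hX, u, hu⟩ := constantCoeff_charGenerator_eq_ordinary_rat p W hgo κ hκ hγ D hK S hS f hf
  refine ⟨hFG, hX, u, ?_⟩
  rw [hu, prod_natCard_localTowerKerPrimary_zero_eq_pow_mul W hord.1 κ hκ hv₀ S hS]
  push_cast
  ring

/-- **Greenberg LNM 1716 Thm. 4.1 over `ℚ`, UNCONDITIONAL in the regime «good ordinary NON-ANOMALOUS `p`, `E(ℚ)[p] = 0`,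
`Sel_{p^∞}(E/ℚ)` finite»: `f(0) = u · #Sel_{p^∞}(E/ℚ) · p^{ord_p ∏_ℓ c_ℓ}`** (all hypotheses as in
`constantCoeff_charGenerator_eq_tamagawa_mul_local_rat`, plus `p ∤ #Ẽ(𝔽_p)`): the local order at `p` is `1`
(`Rank1Residual.Iwasawa.GoodOrdinary.localTowerKerPrimary_zero_eq_bot_of_goodOrdinary_nonAnomalous`, Lemma 3.4 at `n = 0` in
its vanishing case). Supersedes gen 4's `…_eq_natCard_selmer_of_nonAnomalous` (no `p ∤ ∏ c_ℓ` needed).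
[cite: GreenbergLNM1716, Thm. 4.1 (p. 85), §3 Lemmas 3.3–3.4 (pp. 86–89)] -/
theorem constantCoeff_charGenerator_eq_tamagawa_of_nonAnomalous {p : ℕ} [hp : Fact p.Prime]
    (W : WeierstrassCurve ℚ) [W.IsGloballyMinimal] [W.IsElliptic] (hgo : GoodOrd W p)
    (hna : ¬ p ∣ W.reductionPointCount p)
    (κ : ZpExtension ℚ p) (hκ : κ.IsCyclotomic) {γ : absoluteGaloisGroup ℚ} (hγ : κ.IsTopGenerator γ)
    (D : W.SelmerDualData κ γ) [Finite (W.selmerGroupPInfty p)] (hK : ∀ P : W.toAffine.Point, p • P = 0 → P = 0)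
    (f : IwasawaAlgebra p) (hf : Module.charIdeal (IwasawaAlgebra p) D.X = Ideal.span {f}) :
    Module.Finite (IwasawaAlgebra p) D.X ∧ Module.IsTorsion (IwasawaAlgebra p) D.X ∧
      ∃ u : ℤ_[p]ˣ, PowerSeries.constantCoeff f =
        u * Nat.card (W.selmerGroupPInfty p) * p ^ padicValNat p W.tamagawaProduct := by
  have hord : W.HasGoodReductionAtPrime p ∧ ¬ ((p : ℕ) : ℤ) ∣ W.frobeniusTrace p := hgo
  have hΔ : ¬ ((p : ℕ) : ℤ) ∣ minimalDiscriminantInt W :=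
    W.not_dvd_minimalDiscriminantInt_of_hasGoodReductionAtPrime' p hord.1
  -- the place `v₀ ∋ p`
  have hpI : (Ideal.span {((p : ℕ) : 𝓞 ℚ)} : Ideal (𝓞 ℚ)) ≠ ⊤ := by
    rw [Ne, Ideal.span_singleton_eq_top]
    intro hu
    have h1 : IsUnit ((p : ℕ) : ℤ) := by
      have := hu.map (Rat.ringOfIntegersEquiv : 𝓞 ℚ →+* ℤ)
      rwa [map_natCast] at this
    exact hp.out.ne_one (Nat.isUnit_iff.mp (Int.ofNat_isUnit.mp h1))
  obtain ⟨𝔭, h𝔭max, h𝔭le⟩ := Ideal.exists_le_maximal _ hpI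
  have h𝔭0 : 𝔭 ≠ ⊥ := by
    intro h
    rw [h, le_bot_iff, Ideal.span_singleton_eq_bot] at h𝔭le
    exact hp.out.ne_zero (by exact_mod_cast h𝔭le)
  let v₀ : HeightOneSpectrum (𝓞 ℚ) := ⟨𝔭, h𝔭max.isPrime, h𝔭0⟩
  have hv₀ : ((p : ℕ) : 𝓞 ℚ) ∈ v₀.asIdeal := h𝔭le (Ideal.mem_span_singleton_self _)
  obtain ⟨hFG, hX, u, hu⟩ := constantCoeff_charGenerator_eq_tamagawa_mul_local_rat W hgo κ hκ hγ D hK hv₀ f hf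
  refine ⟨hFG, hX, u, ?_⟩
  rw [hu, Summit.BirchSwinnertonDyer.Rank1Residual.Iwasawa.GoodOrdinary.localTowerKerPrimary_zero_eq_bot_of_goodOrdinary_nonAnomalous
    W p hv₀ hΔ hord.2 hna κ hκ, AddSubgroup.card_bot, Nat.cast_one, mul_one]

/-- **The PRINTED shape of Greenberg LNM 1716 Thm. 4.1 over `ℚ` (`E(ℚ)[p] = 0`) from the named fact Lemma 3.4**:
`f(0) = u · p^{ord_p ∏_ℓ c_ℓ} · (p^{ord_p #Ẽ(𝔽_p)})² · #Sel_{p^∞}(E/ℚ)` — CONDITIONAL on the tree's named fact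
`Greenberg1999.lemma34_natCard_localTowerKerPrimary_eq_rat` ("`|ker(r_{v_n})| = |Ẽ(f_{v_n})_p|²`", used at `n = 0` only),
the one input of Thm. 4.1 over `ℚ` in this regime that is not yet a tree theorem (its non-anomalous case is
`constantCoeff_charGenerator_eq_tamagawa_of_nonAnomalous`). [cite: GreenbergLNM1716, Thm. 4.1 (p. 85), §3 Lemma 3.4 (p. 89)] -/
theorem constantCoeff_charGenerator_eq_printed_of_lemma34 {p : ℕ} [hp : Fact p.Prime]
    (h34 : Greenberg1999.lemma34_natCard_localTowerKerPrimary_eq_rat)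
    (W : WeierstrassCurve ℚ) [W.IsGloballyMinimal] [W.IsElliptic] (hgo : GoodOrd W p)
    (κ : ZpExtension ℚ p) (hκ : κ.IsCyclotomic) {γ : absoluteGaloisGroup ℚ} (hγ : κ.IsTopGenerator γ)
    (D : W.SelmerDualData κ γ) [Finite (W.selmerGroupPInfty p)] (hK : ∀ P : W.toAffine.Point, p • P = 0 → P = 0)
    {v₀ : HeightOneSpectrum (𝓞 ℚ)} (hv₀ : ((p : ℕ) : 𝓞 ℚ) ∈ v₀.asIdeal)
    (f : IwasawaAlgebra p) (hf : Module.charIdeal (IwasawaAlgebra p) D.X = Ideal.span {f}) :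
    ∃ u : ℤ_[p]ˣ, PowerSeries.constantCoeff f =
      u * p ^ padicValNat p W.tamagawaProduct * (p ^ padicValNat p (W.reductionPointCount p)) ^ 2 *
        Nat.card (W.selmerGroupPInfty p) := by
  have hord : W.HasGoodReductionAtPrime p ∧ ¬ ((p : ℕ) : ℤ) ∣ W.frobeniusTrace p := hgo
  have hordAt : IsOrdinaryAt W p := hord
  obtain ⟨-, -, u, hu⟩ := constantCoeff_charGenerator_eq_tamagawa_mul_local_rat W hgo κ hκ hγ D hK hv₀ f hf
  obtain ⟨-, h0⟩ := h34 W p hordAt κ hκ v₀ hv₀ 0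
  refine ⟨u, ?_⟩
  rw [hu, h0]
  push_cast
  ring

end Summit.BirchSwinnertonDyer.BirchSwinnertonDyer.Theorems.InputsGreenbergKerG

end
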